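import Literature.NumberTheory.Sieve.CircleMethod
import Literature.NumberTheory.Sieve.BombieriVinogradovReduction

/-!
# Vaughan's decomposition of `ψ(X, χ)` and the weighted sum `T` (setup for Vaughan's Theorem 1)

This file is the elementary half of the discharge of the named fact `Literature.NumberTheory.Sieve.vaughan_meanValue`
(`BombieriVinogradovFacts.lean`; Vaughan, *An elementary method in prime number theory*,
Acta Arith. 37 (1980), 111–115, Theorem 1), completed in `VaughanMeanValue.lean`. It contains
no large-sieve input; everything here is proved from Mathlib, Vaughan's identity
(`Literature.NumberTheory.Sieve.vaughan_identity_add_holds`, `CircleMethod.lean`) and Chebyshev's bound.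

## Contents

* `cU`, `gU`, `fU`, `vonMangoldt_eq_four_terms`: the coefficient functions of Vaughan's
  identity `Λ = Λ_{≤U} + μ_{≤U} * log − c_U * 1 + F_U * G_U`, with `|c_U| ≤ log`, `c_U(d) = 0`
  for `d > U²`, `G_U(m) = 0` for `m ≤ U`, `|G_U| ≤ τ` (Vaughan 1980, (13)–(15));
* `S₁`, `S₂ = S₂' + S₂''`, `S₃` and `chebyshevPsiChar_eq_decomposition`:
  `ψ(X, χ) = ψ(min(U, X), χ) + S₁ − S₂ + S₃` at integers `X` (Vaughan 1980, (12));
* elementary mean values: `sum_sq_card_divisors_le` (`∑_{m ≤ K} τ(m)² ≤ K (1 + log K)³`),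
  `sum_vonMangoldt_sq_le` (`∑_{n ≤ K} Λ(n)² ≤ (log 4 + 4) K log K`), Abel summation for
  `∑ (log m) χ(m)` (`log_eq_sum_Ioc_sub`);
* `Tfun`: Vaughan's weighted sum `T(F) = ∑_{q ≤ Q} (q/φ(q)) ∑*_{χ mod q} |F(q, χ)|` with its
  API (`Tfun_add_le`, `Tfun_sum_le`, `Tfun_le_of_forall_le`, `Tfun_le_of_le_one_of_le`), and
  `exists_cutoff`: the averaged maximum of `vaughan_meanValue` is `T(ψ(X(·), ·))` for
  maximising integer cut-offs `X(q, χ) ≤ ⌊Y⌋`;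
* the logarithmic unit `ell Y₀ = 1 + log Y₀`, the trivial piece `Tfun_psi_min_le`
  (`T(ψ(min(U, ·), ·)) ≤ (log 4 + 4) U Q²`), the truncations `norm_S₁_le`, `norm_S₂'_le` and the
  trivial bounds `norm_S₁_le_trivial`, `norm_S₂'_le_trivial` (`≤ Y₀ ℓ²`);
* dyadic blocks `blockSum a b M X χ = ∑_{M < d ≤ 2M} a(d) ∑_{m ≤ X/d} b(m) χ(dm)`:
  `S₂''_eq_sum_blockSum`, `S₃_eq_sum_blockSum`, the hyperbolic form `blockSum_eq_sum_ite`, the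
  vanishing blocks `blockSum_cU_eq_zero` (`M ≥ U²`), `blockSum_fU_gU_eq_zero` (`UM ≥ Y₀`), and
  the coefficient mean squares `sum_sq_cU_le`, `sum_sq_fU_le`, `sum_sq_gU_le`;
* `chebyshevPsiChar_eq_sum_ite`: `ψ(X, χ)` as a one-row bilinear form with the cut-off
  `n ≤ X` (for the case `Q² > Y`).

## References

* R. C. Vaughan, *An elementary method in prime number theory*, Acta Arith. 37 (1980),
  111–115, §2, (10)–(15). [Vaughan1980]
* H. Davenport, *Multiplicative Number Theory*, 2nd ed. (Springer, 1980), ch. 24 (Vaughan's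
  identity) and ch. 28. [DavenportMNT1980]
-/

open Finset Real Complex

namespace Literature.NumberTheory.Sieve.Vaughan

open ArithmeticFunction
open scoped ArithmeticFunction.Moebius ArithmeticFunction.zeta ArithmeticFunction.sigma Pointwise

/-- `(f - g)(n) = f(n) - g(n)` for arithmetic functions (Mathlib has `add_apply`, `neg_apply`).
[folklore] -/
theorem arith_sub_apply {R : Type*} [AddGroup R] (f g : ArithmeticFunction R) (n : ℕ) :
    (f - g) n = f n - g n := by
  rw [sub_eq_add_neg, ArithmeticFunction.add_apply, ArithmeticFunction.neg_apply, sub_eq_add_neg]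

/-! ### Dirichlet's rearrangement of a convolution sum -/

/-- **Dirichlet's rearrangement**: `∑_{n ≤ N} ∑_{dm = n} F(d, m) = ∑_{d ≤ N} ∑_{m ≤ N/d} F(d, m)`.
[folklore] -/
theorem sum_Ioc_sum_divisorsAntidiagonal_eq {M : Type*} [AddCommMonoid M] (F : ℕ → ℕ → M)
    (N : ℕ) :
    ∑ n ∈ Ioc 0 N, ∑ x ∈ n.divisorsAntidiagonal, F x.1 x.2 =
      ∑ d ∈ Ioc 0 N, ∑ m ∈ Ioc 0 (N / d), F d m := by
  rw [sum_sigma', sum_sigma']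
  refine sum_nbij' (fun p => ⟨p.2.1, p.2.2⟩) (fun p => ⟨p.1 * p.2, (p.1, p.2)⟩) ?_ ?_ ?_ ?_
    (fun _ _ => rfl)
  · rintro ⟨n, ⟨d, m⟩⟩ hp
    simp only [mem_sigma, mem_Ioc, Nat.mem_divisorsAntidiagonal] at hp ⊢
    obtain ⟨⟨hn0, hnN⟩, hdm, -⟩ := hp
    have hd : 0 < d := Nat.pos_of_ne_zero fun h => by rw [h, zero_mul] at hdm; omega
    have hm : 0 < m := Nat.pos_of_ne_zero fun h => by rw [h, mul_zero] at hdm; omega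
    refine ⟨⟨hd, ?_⟩, hm, ?_⟩
    · nlinarith
    · rw [Nat.le_div_iff_mul_le hd]; nlinarith
  · rintro ⟨d, m⟩ hp
    simp only [mem_sigma, mem_Ioc, Nat.mem_divisorsAntidiagonal] at hp ⊢
    obtain ⟨⟨hd0, hdN⟩, hm0, hm⟩ := hp
    rw [Nat.le_div_iff_mul_le hd0] at hm
    refine ⟨⟨Nat.mul_pos hd0 hm0, by nlinarith⟩, trivial, (Nat.mul_pos hd0 hm0).ne'⟩
  · rintro ⟨n, ⟨d, m⟩⟩ hp
    simp only [mem_sigma, mem_Ioc, Nat.mem_divisorsAntidiagonal] at hp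
    obtain ⟨-, hdm, -⟩ := hp
    simp only [hdm]
  · rintro ⟨d, m⟩ _
    rfl

/-- The hyperbola `{dm ≤ N}` as a box with an indicator: for `N ≤ B, B'`,
`∑_{d ≤ N} ∑_{m ≤ N/d} F(d, m) = ∑_{d ≤ B} ∑_{m ≤ B'} [dm ≤ N] F(d, m)`. [folklore] -/
theorem sum_Ioc_sum_Ioc_div_eq_sum_sum_ite {M : Type*} [AddCommMonoid M] (F : ℕ → ℕ → M)
    {N B B' : ℕ} (hB : N ≤ B) (hB' : N ≤ B') :
    ∑ d ∈ Ioc 0 N, ∑ m ∈ Ioc 0 (N / d), F d m =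
      ∑ d ∈ Ioc 0 B, ∑ m ∈ Ioc 0 B', if d * m ≤ N then F d m else 0 := by
  have inner : ∀ d ∈ Ioc 0 B, (∑ m ∈ Ioc 0 B', if d * m ≤ N then F d m else 0) =
      ∑ m ∈ Ioc 0 (N / d), F d m := by
    intro d hd
    rw [mem_Ioc] at hd
    rw [← sum_filter]
    refine sum_congr ?_ fun _ _ => rfl
    ext m
    simp only [mem_filter, mem_Ioc, Nat.le_div_iff_mul_le hd.1]
    constructor
    · rintro ⟨⟨hm0, -⟩, hdm⟩; exact ⟨hm0, by rwa [mul_comm] at hdm⟩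
    · rintro ⟨hm0, hmd⟩
      exact ⟨⟨hm0, le_trans (le_trans (Nat.le_mul_of_pos_right m hd.1) hmd) hB'⟩,
        by rwa [mul_comm] at hmd⟩
  rw [sum_congr rfl inner]
  refine sum_subset (Ioc_subset_Ioc_right hB) fun d hd hdN => ?_
  rw [mem_Ioc] at hd
  rw [mem_Ioc, not_and, not_le] at hdN
  rw [Nat.div_eq_of_lt (hdN hd.1)]
  simp

/-- Shrinking a box sum when the summand vanishes outside. [folklore] -/
theorem sum_Ioc_eq_sum_Ioc_of_eq_zero {M : Type*} [AddCommMonoid M] {f : ℕ → M} {A B : ℕ}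
    (hAB : A ≤ B) (h : ∀ d, A < d → d ≤ B → f d = 0) :
    ∑ d ∈ Ioc 0 B, f d = ∑ d ∈ Ioc 0 A, f d := by
  symm
  refine sum_subset (Ioc_subset_Ioc_right hAB) fun d hd hdA => ?_
  rw [mem_Ioc] at hd
  rw [mem_Ioc, not_and, not_le] at hdA
  exact h d (hdA hd.1) hd.2

/-! ### The coefficient functions of Vaughan's identity -/

/-- `c_U = μ_{≤U} * Λ_{≤U}` (Vaughan 1980, (14): `c_m = ∑_{ab = m, a ≤ u, b ≤ u} μ(a) Λ(b)`).
[cite: Vaughan1980, (14)] -/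
noncomputable def cU (U : ℕ) : ArithmeticFunction ℝ :=
  (Literature.NumberTheory.Sieve.moebiusTrunc U : ArithmeticFunction ℝ) * Literature.NumberTheory.Sieve.vonMangoldtTrunc U

/-- `G_U = (μ − μ_{≤U}) * ζ`, i.e. `G_U(m) = ∑_{e ∣ m, e > U} μ(e)`; for `m > U` this is
`−τ_m = −∑_{d ∣ m, d ≤ u} μ(d)` of Vaughan 1980, (15). [cite: Vaughan1980, (15)] -/
noncomputable def gU (U : ℕ) : ArithmeticFunction ℝ :=
  ((μ : ArithmeticFunction ℝ) - (Literature.NumberTheory.Sieve.moebiusTrunc U : ArithmeticFunction ℝ)) *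
    (ζ : ArithmeticFunction ℝ)

/-- `F_U = Λ − Λ_{≤U}`, i.e. `Λ` restricted to `n > U`. [folklore] -/
noncomputable def fU (U : ℕ) : ArithmeticFunction ℝ := Λ - Literature.NumberTheory.Sieve.vonMangoldtTrunc U

/-- `F_U(d) = Λ(d)` for `d > U` and `0` otherwise. [folklore] -/
theorem fU_apply (U d : ℕ) : fU U d = if d ≤ U then 0 else Λ d := by
  rw [fU, arith_sub_apply, Literature.NumberTheory.Sieve.vonMangoldtTrunc_apply]
  split_ifs <;> simp

/-- `|F_U(d)| ≤ Λ(d)`. [folklore] -/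
theorem abs_fU_le (U d : ℕ) : |fU U d| ≤ Λ d := by
  rw [fU_apply]
  split_ifs
  · rw [abs_zero]; exact vonMangoldt_nonneg
  · exact (abs_of_nonneg vonMangoldt_nonneg).le

/-- `|μ_{≤U}(a)| ≤ 1`. [folklore] -/
theorem abs_moebiusTrunc_le_one (U a : ℕ) : |((Literature.NumberTheory.Sieve.moebiusTrunc U a : ℤ) : ℝ)| ≤ 1 := by
  rw [Literature.NumberTheory.Sieve.moebiusTrunc_apply]
  split_ifs
  · rw [← Int.cast_abs]; exact_mod_cast abs_moebius_le_one
  · simp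

/-- `|c_U(d)| ≤ ∑_{b ∣ d} Λ(b) = log d`. [folklore] -/
theorem abs_cU_le_log (U d : ℕ) : |cU U d| ≤ Real.log d := by
  rw [cU, mul_apply]
  refine (abs_sum_le_sum_abs _ _).trans ?_
  calc ∑ x ∈ d.divisorsAntidiagonal, |((Literature.NumberTheory.Sieve.moebiusTrunc U : ArithmeticFunction ℝ)) x.1 *
          Literature.NumberTheory.Sieve.vonMangoldtTrunc U x.2|
      ≤ ∑ x ∈ d.divisorsAntidiagonal, Λ x.2 := by
        refine sum_le_sum fun x _ => ?_
        rw [abs_mul, intCoe_apply, Literature.NumberTheory.Sieve.vonMangoldtTrunc_apply]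
        have h1 := abs_moebiusTrunc_le_one U x.1
        have h2 : |(if x.2 ≤ U then Λ x.2 else 0 : ℝ)| ≤ Λ x.2 := by
          split_ifs
          · exact (abs_of_nonneg vonMangoldt_nonneg).le
          · rw [abs_zero]; exact vonMangoldt_nonneg
        calc _ ≤ 1 * Λ x.2 := mul_le_mul h1 h2 (abs_nonneg _) zero_le_one
          _ = Λ x.2 := one_mul _
    _ = Real.log d := by
        rw [Nat.sum_divisorsAntidiagonal' (fun _ b => (Λ b : ℝ))]
        exact vonMangoldt_sum

/-- `c_U(d) = 0` for `d > U²`. [folklore] -/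
theorem cU_eq_zero_of_lt {U d : ℕ} (hd : U * U < d) : cU U d = 0 := by
  rw [cU, mul_apply]
  refine sum_eq_zero fun x hx => ?_
  rw [Nat.mem_divisorsAntidiagonal] at hx
  rw [intCoe_apply, Literature.NumberTheory.Sieve.moebiusTrunc_apply, Literature.NumberTheory.Sieve.vonMangoldtTrunc_apply]
  by_cases h1 : x.1 ≤ U
  · by_cases h2 : x.2 ≤ U
    · exfalso
      have : x.1 * x.2 ≤ U * U := Nat.mul_le_mul h1 h2
      omega
    · simp [h2]
  · simp [h1]

/-- `G_U(m) = ∑_{e ∣ m, e > U} μ(e)`. [folklore] -/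
theorem gU_apply (U m : ℕ) :
    gU U m = ∑ e ∈ m.divisors, if e ≤ U then (0 : ℝ) else (μ e : ℝ) := by
  rw [gU, coe_mul_zeta_apply]
  refine sum_congr rfl fun e _ => ?_
  rw [arith_sub_apply, intCoe_apply, intCoe_apply, Literature.NumberTheory.Sieve.moebiusTrunc_apply]
  split_ifs <;> simp

/-- `G_U(m) = 0` for `1 ≤ m ≤ U` (every divisor is `≤ U`). [folklore] -/
theorem gU_eq_zero_of_le {U m : ℕ} (hm : m ≤ U) : gU U m = 0 := by
  rw [gU_apply]
  refine sum_eq_zero fun e he => ?_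
  rw [if_pos ((Nat.divisor_le he).trans hm)]

/-- `|G_U(m)| ≤ τ(m) = σ₀(m)`. [folklore] -/
theorem abs_gU_le (U m : ℕ) : |gU U m| ≤ σ 0 m := by
  rw [gU_apply, sigma_zero_apply]
  refine (abs_sum_le_sum_abs _ _).trans ?_
  calc ∑ e ∈ m.divisors, |(if e ≤ U then (0 : ℝ) else (μ e : ℝ))| ≤ ∑ e ∈ m.divisors, (1 : ℝ) := by
        refine sum_le_sum fun e _ => ?_
        split_ifs
        · simp
        · rw [← Int.cast_abs]; exact_mod_cast abs_moebius_le_one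
    _ = #m.divisors := by simp

/-- **Vaughan's identity regrouped**: `Λ = Λ_{≤U} + μ_{≤U} * log − c_U * ζ + F_U * G_U`
(from `Literature.vaughan_identity_add_holds U U`). [cite: Vaughan1980, (12)–(16)] -/
theorem vonMangoldt_eq_four_terms (U : ℕ) :
    (Λ : ArithmeticFunction ℝ) = Literature.NumberTheory.Sieve.vonMangoldtTrunc U +
      (Literature.NumberTheory.Sieve.moebiusTrunc U : ArithmeticFunction ℝ) * ArithmeticFunction.log -
        cU U * (ζ : ArithmeticFunction ℝ) + fU U * gU U := by
  have h := Literature.NumberTheory.Sieve.vaughan_identity_add_holds U U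
  rw [h, cU, fU, gU]
  ring

/-! ### The three sums `S₁, S₂, S₃` -/

/-- `S₁(X, χ) = ∑_{d ≤ X} μ_{≤U}(d) χ(d) ∑_{m ≤ X/d} (log m) χ(m)` (Vaughan 1980, (13)).
[cite: Vaughan1980, (13)] -/
noncomputable def S₁ (U X : ℕ) {q : ℕ} (χ : DirichletCharacter ℂ q) : ℂ :=
  ∑ d ∈ Ioc 0 X, ((Literature.NumberTheory.Sieve.moebiusTrunc U d : ℤ) : ℂ) * χ d *
    ∑ m ∈ Ioc 0 (X / d), (Real.log m : ℂ) * χ m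

/-- `S₂(X, χ) = ∑_{d ≤ X} c_U(d) ∑_{m ≤ X/d} χ(dm)` (Vaughan 1980, (14)).
[cite: Vaughan1980, (14)] -/
noncomputable def S₂ (U X : ℕ) {q : ℕ} (χ : DirichletCharacter ℂ q) : ℂ :=
  ∑ d ∈ Ioc 0 X, (cU U d : ℂ) * ∑ m ∈ Ioc 0 (X / d), χ (d * m)

/-- `S₃(X, χ) = ∑_{d ≤ X} F_U(d) ∑_{m ≤ X/d} G_U(m) χ(dm) = −∑∑_{m,n > U, mn ≤ X} τ_m Λ(n) χ(mn)`
(Vaughan 1980, (15), up to sign). [cite: Vaughan1980, (15)] -/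
noncomputable def S₃ (U X : ℕ) {q : ℕ} (χ : DirichletCharacter ℂ q) : ℂ :=
  ∑ d ∈ Ioc 0 X, (fU U d : ℂ) * ∑ m ∈ Ioc 0 (X / d), (gU U m : ℂ) * χ (d * m)

/-- `ψ(X, χ)` at an integer as a sum over `0 < n ≤ X`. [folklore] -/
theorem chebyshevPsiChar_natCast {q : ℕ} (χ : DirichletCharacter ℂ q) (X : ℕ) :
    chebyshevPsiChar χ X = ∑ n ∈ Ioc 0 X, (Λ n : ℂ) * χ n := by
  rw [chebyshevPsiChar, Nat.floor_natCast, sum_range_succ_eq_sum_Ioc' _ (by simp)]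
  exact sum_congr rfl fun n _ => mul_comm _ _

/-- A weighted convolution sum against `χ`, opened up:
`∑_{n ≤ X} (f * g)(n) χ(n) = ∑_{d ≤ X} f(d) ∑_{m ≤ X/d} g(m) χ(dm)`. [folklore] -/
theorem sum_Ioc_mul_apply_mul_char (f g : ArithmeticFunction ℝ) {q : ℕ}
    (χ : DirichletCharacter ℂ q) (X : ℕ) :
    ∑ n ∈ Ioc 0 X, ((f * g) n : ℂ) * χ n =
      ∑ d ∈ Ioc 0 X, (f d : ℂ) * ∑ m ∈ Ioc 0 (X / d), (g m : ℂ) * χ (d * m) := by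
  have h1 : ∀ n ∈ Ioc 0 X, ((f * g) n : ℂ) * χ n =
      ∑ x ∈ n.divisorsAntidiagonal, (f x.1 : ℂ) * ((g x.2 : ℂ) * χ (x.1 * x.2)) := by
    intro n _
    rw [mul_apply, Complex.ofReal_sum, sum_mul]
    refine sum_congr rfl fun x hx => ?_
    rw [← (Nat.mem_divisorsAntidiagonal.1 hx).1, Nat.cast_mul]; push_cast; ring
  rw [sum_congr rfl h1, sum_Ioc_sum_divisorsAntidiagonal_eq
    (fun d m => (f d : ℂ) * ((g m : ℂ) * χ (d * m))) X]
  simp only [mul_sum]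

/-- **Vaughan's decomposition of `ψ(X, χ)`**: for every `U ≥ 1` and integer `X`,
`ψ(X, χ) = ψ(min(U, X), χ) + S₁(X, χ) − S₂(X, χ) + S₃(X, χ)`
(Vaughan 1980, (12) with `f = χ`, `u = U` in both truncations). [cite: Vaughan1980, (12)] -/
theorem chebyshevPsiChar_eq_decomposition (U X : ℕ) {q : ℕ} (χ : DirichletCharacter ℂ q) :
    chebyshevPsiChar χ X =
      chebyshevPsiChar χ ((min U X : ℕ) : ℝ) + S₁ U X χ - S₂ U X χ + S₃ U X χ := by
  have hΛ : ∀ n : ℕ, (Λ n : ℝ) = Literature.NumberTheory.Sieve.vonMangoldtTrunc U n +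
      ((Literature.NumberTheory.Sieve.moebiusTrunc U : ArithmeticFunction ℝ) * ArithmeticFunction.log) n -
        (cU U * (ζ : ArithmeticFunction ℝ)) n + (fU U * gU U) n := by
    intro n
    have h := congrArg (fun F : ArithmeticFunction ℝ => F n) (vonMangoldt_eq_four_terms U)
    simpa only [ArithmeticFunction.add_apply, arith_sub_apply] using h
  -- term 0: `∑_{n ≤ X} Λ_{≤U}(n) χ(n) = ψ(min U X, χ)`
  have h0 : ∑ n ∈ Ioc 0 X, (Literature.NumberTheory.Sieve.vonMangoldtTrunc U n : ℂ) * χ n =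
      chebyshevPsiChar χ ((min U X : ℕ) : ℝ) := by
    have hvan : ∀ n, min U X < n → n ≤ X → (Literature.NumberTheory.Sieve.vonMangoldtTrunc U n : ℂ) * χ n = 0 := by
      intro n hn hnX
      rw [Literature.NumberTheory.Sieve.vonMangoldtTrunc_apply, if_neg (by omega), Complex.ofReal_zero, zero_mul]
    rw [sum_Ioc_eq_sum_Ioc_of_eq_zero (min_le_right U X) hvan, chebyshevPsiChar_natCast]
    refine sum_congr rfl fun n hn => ?_
    rw [mem_Ioc] at hn
    rw [Literature.NumberTheory.Sieve.vonMangoldtTrunc_apply, if_pos (by omega)]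
  -- term 1
  have h1 : ∑ n ∈ Ioc 0 X, (((Literature.NumberTheory.Sieve.moebiusTrunc U : ArithmeticFunction ℝ) *
      ArithmeticFunction.log) n : ℂ) * χ n = S₁ U X χ := by
    rw [sum_Ioc_mul_apply_mul_char, S₁]
    refine sum_congr rfl fun d _ => ?_
    simp only [mul_sum, intCoe_apply, log_apply]
    refine sum_congr rfl fun m _ => ?_
    rw [map_mul]; push_cast; ring
  -- term 2
  have h2 : ∑ n ∈ Ioc 0 X, ((cU U * (ζ : ArithmeticFunction ℝ)) n : ℂ) * χ n = S₂ U X χ := by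
    rw [sum_Ioc_mul_apply_mul_char, S₂]
    refine sum_congr rfl fun d _ => ?_
    congr 1
    refine sum_congr rfl fun m hm => ?_
    rw [mem_Ioc] at hm
    rw [natCoe_apply, zeta_apply, if_neg (by omega)]; push_cast; ring
  -- term 3
  have h3 : ∑ n ∈ Ioc 0 X, ((fU U * gU U) n : ℂ) * χ n = S₃ U X χ := by
    rw [sum_Ioc_mul_apply_mul_char, S₃]
  rw [chebyshevPsiChar_natCast]
  have hsum : ∑ n ∈ Ioc 0 X, (Λ n : ℂ) * χ n =
      ∑ n ∈ Ioc 0 X, ((Literature.NumberTheory.Sieve.vonMangoldtTrunc U n : ℂ) * χ n +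
        (((Literature.NumberTheory.Sieve.moebiusTrunc U : ArithmeticFunction ℝ) * ArithmeticFunction.log) n : ℂ) * χ n -
        ((cU U * (ζ : ArithmeticFunction ℝ)) n : ℂ) * χ n + ((fU U * gU U) n : ℂ) * χ n) :=
    sum_congr rfl fun n _ => by rw [hΛ n]; push_cast; ring
  rw [hsum, sum_add_distrib, sum_sub_distrib, sum_add_distrib, h0, h1, h2, h3]

/-! ### Divisor sums: `∑_{m ≤ K} τ(m)² ≤ K (1 + log K)³` -/

/-- `Ioc 0 K = Icc 1 K` in `ℕ`. [folklore] -/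
theorem Ioc_zero_eq_Icc_one (K : ℕ) : Ioc 0 K = Icc 1 K := by
  ext m; simp only [mem_Ioc, mem_Icc]; omega

/-- `∑_{0 < e ≤ K} 1/e ≤ 1 + log K`. [folklore] -/
theorem sum_Ioc_inv_le (K : ℕ) : ∑ e ∈ Ioc 0 K, ((e : ℝ))⁻¹ ≤ 1 + Real.log K := by
  rw [Ioc_zero_eq_Icc_one]; exact harmonic_Icc_le K

/-- `τ(ab) ≤ τ(a) τ(b)`. [folklore] -/
theorem card_divisors_mul_le (a b : ℕ) : #(a * b).divisors ≤ #a.divisors * #b.divisors := by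
  rw [Nat.divisors_mul]; exact Finset.card_mul_le

/-- `τ(b) = #{(e, f) : ef = b}`. [folklore] -/
theorem card_divisors_eq_sum_antidiagonal (b : ℕ) :
    (#b.divisors : ℝ) = ∑ _x ∈ b.divisorsAntidiagonal, (1 : ℝ) := by
  rw [Nat.sum_divisorsAntidiagonal (fun _ _ => (1 : ℝ)), sum_const, nsmul_eq_mul, mul_one]

/-- `∑_{b ≤ Z} τ(b) ≤ Z (1 + log Z)`. [folklore] -/
theorem sum_card_divisors_le (Z : ℕ) :
    ∑ b ∈ Ioc 0 Z, (#b.divisors : ℝ) ≤ Z * (1 + Real.log Z) := by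
  have h1 : ∑ b ∈ Ioc 0 Z, (#b.divisors : ℝ) = ∑ e ∈ Ioc 0 Z, ((Z / e : ℕ) : ℝ) := by
    rw [sum_congr rfl fun b _ => card_divisors_eq_sum_antidiagonal b,
      sum_Ioc_sum_divisorsAntidiagonal_eq (fun _ _ => (1 : ℝ)) Z]
    simp
  rw [h1]
  calc ∑ e ∈ Ioc 0 Z, ((Z / e : ℕ) : ℝ) ≤ ∑ e ∈ Ioc 0 Z, (Z : ℝ) * ((e : ℝ))⁻¹ := by
        refine sum_le_sum fun e he => ?_
        rw [← div_eq_mul_inv]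
        exact Nat.cast_div_le
    _ = Z * ∑ e ∈ Ioc 0 Z, ((e : ℝ))⁻¹ := by rw [mul_sum]
    _ ≤ Z * (1 + Real.log Z) := mul_le_mul_of_nonneg_left (sum_Ioc_inv_le Z) (Nat.cast_nonneg Z)

/-- `∑_{a ≤ K} τ(a)/a ≤ (1 + log K)²`. [folklore] -/
theorem sum_card_divisors_div_le (K : ℕ) :
    ∑ a ∈ Ioc 0 K, (#a.divisors : ℝ) / a ≤ (1 + Real.log K) ^ 2 := by
  have h1 : ∀ a ∈ Ioc 0 K, (#a.divisors : ℝ) / a =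
      ∑ x ∈ a.divisorsAntidiagonal, ((x.1 : ℝ))⁻¹ * ((x.2 : ℝ))⁻¹ := by
    intro a ha
    rw [card_divisors_eq_sum_antidiagonal, sum_div]
    refine sum_congr rfl fun x hx => ?_
    rw [Nat.mem_divisorsAntidiagonal] at hx
    rw [← hx.1, Nat.cast_mul, ← mul_inv, one_div]
  rw [sum_congr rfl h1,
    sum_Ioc_sum_divisorsAntidiagonal_eq (fun e f => ((e : ℝ))⁻¹ * ((f : ℝ))⁻¹) K]
  have hlog : 0 ≤ 1 + Real.log K := by
    rcases Nat.eq_zero_or_pos K with rfl | hK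
    · simp
    · have := Real.log_nonneg (show (1 : ℝ) ≤ K by exact_mod_cast hK); linarith
  calc ∑ e ∈ Ioc 0 K, ∑ f ∈ Ioc 0 (K / e), ((e : ℝ))⁻¹ * ((f : ℝ))⁻¹
      ≤ ∑ e ∈ Ioc 0 K, ((e : ℝ))⁻¹ * (1 + Real.log K) := by
        refine sum_le_sum fun e _ => ?_
        rw [← mul_sum]
        refine mul_le_mul_of_nonneg_left ?_ (by positivity)
        refine le_trans (sum_le_sum_of_subset_of_nonneg (Ioc_subset_Ioc_right (Nat.div_le_self K e))
          fun _ _ _ => by positivity) (sum_Ioc_inv_le K)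
    _ ≤ (1 + Real.log K) * (1 + Real.log K) := by
        rw [← sum_mul]; exact mul_le_mul_of_nonneg_right (sum_Ioc_inv_le K) hlog
    _ = (1 + Real.log K) ^ 2 := (sq _).symm

/-- **Mean square of the divisor function** (crude form): `∑_{m ≤ K} τ(m)² ≤ K (1 + log K)³`
(the true order is `K log³ K / π²`). [folklore] -/
theorem sum_sq_card_divisors_le (K : ℕ) :
    ∑ m ∈ Ioc 0 K, ((#m.divisors : ℕ) : ℝ) ^ 2 ≤ K * (1 + Real.log K) ^ 3 := by
  have hlog : 0 ≤ 1 + Real.log K := by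
    rcases Nat.eq_zero_or_pos K with rfl | hK
    · simp
    · have := Real.log_nonneg (show (1 : ℝ) ≤ K by exact_mod_cast hK); linarith
  -- `τ(m)² = ∑_{ab = m} τ(ab) ≤ ∑_{ab = m} τ(a) τ(b)`
  have h1 : ∀ m ∈ Ioc 0 K, ((#m.divisors : ℕ) : ℝ) ^ 2 ≤
      ∑ x ∈ m.divisorsAntidiagonal, (#x.1.divisors : ℝ) * #x.2.divisors := by
    intro m _
    have e1 := card_divisors_eq_sum_antidiagonal m
    calc ((#m.divisors : ℕ) : ℝ) ^ 2 = (∑ x ∈ m.divisorsAntidiagonal, (1 : ℝ)) * #m.divisors := by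
          rw [← e1, sq]
      _ = ∑ x ∈ m.divisorsAntidiagonal, (#m.divisors : ℝ) := by rw [sum_mul]; simp
      _ ≤ ∑ x ∈ m.divisorsAntidiagonal, (#x.1.divisors : ℝ) * #x.2.divisors := by
          refine sum_le_sum fun x hx => ?_
          rw [Nat.mem_divisorsAntidiagonal] at hx
          rw [← hx.1]
          exact_mod_cast card_divisors_mul_le x.1 x.2
  refine (sum_le_sum h1).trans ?_
  rw [sum_Ioc_sum_divisorsAntidiagonal_eq (fun a b => (#a.divisors : ℝ) * #b.divisors) K]
  calc ∑ a ∈ Ioc 0 K, ∑ b ∈ Ioc 0 (K / a), (#a.divisors : ℝ) * #b.divisors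
      ≤ ∑ a ∈ Ioc 0 K, (#a.divisors : ℝ) * ((K : ℝ) / a * (1 + Real.log K)) := by
        refine sum_le_sum fun a ha => ?_
        rw [mem_Ioc] at ha
        rw [← mul_sum]
        refine mul_le_mul_of_nonneg_left ((sum_card_divisors_le (K / a)).trans ?_) (by positivity)
        have hKa : ((K / a : ℕ) : ℝ) ≤ (K : ℝ) / a := Nat.cast_div_le
        have hlog' : Real.log ((K / a : ℕ) : ℝ) ≤ Real.log K := by
          rcases Nat.eq_zero_or_pos (K / a) with h0 | hpos
          · rw [h0, Nat.cast_zero, Real.log_zero]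
            exact Real.log_nonneg (by exact_mod_cast (show 1 ≤ K by omega))
          · exact Real.log_le_log (by exact_mod_cast hpos) (by exact_mod_cast Nat.div_le_self K a)
        have h3 : 0 ≤ 1 + Real.log ((K / a : ℕ) : ℝ) := by
          rcases Nat.eq_zero_or_pos (K / a) with h0 | hpos
          · rw [h0, Nat.cast_zero, Real.log_zero]; norm_num
          · have := Real.log_nonneg (show (1 : ℝ) ≤ (K / a : ℕ) by exact_mod_cast hpos); linarith
        calc ((K / a : ℕ) : ℝ) * (1 + Real.log ((K / a : ℕ) : ℝ))
            ≤ (K : ℝ) / a * (1 + Real.log ((K / a : ℕ) : ℝ)) := mul_le_mul_of_nonneg_right hKa h3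
          _ ≤ (K : ℝ) / a * (1 + Real.log K) := by gcongr
    _ = K * (1 + Real.log K) * ∑ a ∈ Ioc 0 K, (#a.divisors : ℝ) / a := by
        rw [mul_sum]; exact sum_congr rfl fun a _ => by ring
    _ ≤ K * (1 + Real.log K) * (1 + Real.log K) ^ 2 :=
        mul_le_mul_of_nonneg_left (sum_card_divisors_div_le K) (by positivity)
    _ = K * (1 + Real.log K) ^ 3 := by ring

/-- `∑_{n ≤ K} Λ(n)² ≤ ψ(K) log K ≤ (log 4 + 4) K log K` (Chebyshev's bound, Mathlib's
`Chebyshev.psi_le_const_mul_self`). [folklore] -/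
theorem sum_vonMangoldt_sq_le (K : ℕ) :
    ∑ n ∈ Ioc 0 K, (Λ n) ^ 2 ≤ (Real.log 4 + 4) * K * Real.log K := by
  rcases Nat.eq_zero_or_pos K with rfl | hK
  · simp
  have hlogK : 0 ≤ Real.log K := Real.log_nonneg (by exact_mod_cast hK)
  calc ∑ n ∈ Ioc 0 K, (Λ n) ^ 2 ≤ ∑ n ∈ Ioc 0 K, Λ n * Real.log K := by
        refine sum_le_sum fun n hn => ?_
        rw [mem_Ioc] at hn
        rw [sq]
        refine mul_le_mul_of_nonneg_left (vonMangoldt_le_log.trans ?_) vonMangoldt_nonneg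
        exact Real.log_le_log (by exact_mod_cast hn.1) (by exact_mod_cast hn.2)
    _ = Chebyshev.psi K * Real.log K := by rw [← sum_mul, Chebyshev.psi, Nat.floor_natCast]
    _ ≤ (Real.log 4 + 4) * K * Real.log K :=
        mul_le_mul_of_nonneg_right (Chebyshev.psi_le_const_mul_self (Nat.cast_nonneg K)) hlogK

/-- `log m` as a telescoping sum: `log m = ∑_{0 < j ≤ m} (log j − log(j − 1))`. [folklore] -/
theorem log_eq_sum_Ioc_sub (m : ℕ) :
    Real.log m = ∑ j ∈ Ioc 0 m, (Real.log j - Real.log (j - 1 : ℕ)) := by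
  induction m with
  | zero => simp
  | succ n ih =>
    rw [Finset.sum_Ioc_succ_top (Nat.zero_le _), ← ih, Nat.add_sub_cancel]
    ring

/-- The increments `log j − log(j − 1)` are nonnegative. [folklore] -/
theorem log_sub_log_pred_nonneg (j : ℕ) : 0 ≤ Real.log j - Real.log (j - 1 : ℕ) := by
  rcases Nat.eq_zero_or_pos j with rfl | hj
  · simp
  · rcases Nat.eq_or_lt_of_le hj with h1 | h1
    · subst h1; simp
    · have : Real.log ((j - 1 : ℕ) : ℝ) ≤ Real.log j :=
        Real.log_le_log (by exact_mod_cast (by omega : 0 < j - 1))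
          (by exact_mod_cast Nat.sub_le j 1)
      linarith

/-- The trivial bound `|∑_{m ∈ s} f(m) χ(m)| ≤ ∑_{m ∈ s} |f(m)|`. [folklore] -/
theorem norm_sum_mul_char_le {q : ℕ} (χ : DirichletCharacter ℂ q) (s : Finset ℕ) (f : ℕ → ℂ) :
    ‖∑ m ∈ s, f m * χ m‖ ≤ ∑ m ∈ s, ‖f m‖ := by
  refine (norm_sum_le _ _).trans (sum_le_sum fun m _ => ?_)
  rw [norm_mul]
  exact mul_le_of_le_one_right (norm_nonneg _) (χ.norm_le_one _)

/-- `∑_{m ≤ Z} log m ≤ Z log Z`. [folklore] -/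
theorem sum_Ioc_log_le (Z : ℕ) : ∑ m ∈ Ioc 0 Z, Real.log m ≤ Z * Real.log Z := by
  calc ∑ m ∈ Ioc 0 Z, Real.log m ≤ ∑ m ∈ Ioc 0 Z, Real.log Z := by
        refine sum_le_sum fun m hm => ?_
        rw [mem_Ioc] at hm
        exact Real.log_le_log (by exact_mod_cast hm.1) (by exact_mod_cast hm.2)
    _ = Z * Real.log Z := by simp

/-! ### The cut-off `m ≤ X/d` as an indicator -/

/-- For `0 < d` and `X/d ≤ B'`: `∑_{m ≤ X/d} f(m) = ∑_{m ≤ B'} [dm ≤ X] f(m)`. [folklore] -/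
theorem sum_Ioc_div_eq_sum_ite {M : Type*} [AddCommMonoid M] (f : ℕ → M) {d X B' : ℕ}
    (hd : 0 < d) (hB' : X / d ≤ B') :
    ∑ m ∈ Ioc 0 (X / d), f m = ∑ m ∈ Ioc 0 B', if d * m ≤ X then f m else 0 := by
  rw [← sum_filter]
  refine sum_congr ?_ fun _ _ => rfl
  ext m
  simp only [mem_filter, mem_Ioc, Nat.le_div_iff_mul_le hd]
  constructor
  · rintro ⟨hm0, hmd⟩
    refine ⟨⟨hm0, ?_⟩, by rwa [mul_comm] at hmd⟩
    exact le_trans ((Nat.le_div_iff_mul_le hd).2 hmd) hB'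
  · rintro ⟨⟨hm0, -⟩, hdm⟩; exact ⟨hm0, by rwa [mul_comm] at hdm⟩

/-- Dyadic decomposition of `(U, U 2^J]`. [folklore] -/
theorem sum_Ioc_mul_two_pow_eq_sum {M : Type*} [AddCommMonoid M] (f : ℕ → M) (U J : ℕ) :
    ∑ d ∈ Ioc U (U * 2 ^ J), f d =
      ∑ i ∈ range J, ∑ d ∈ Ioc (U * 2 ^ i) (U * 2 ^ i + U * 2 ^ i), f d := by
  induction J with
  | zero => simp
  | succ J ih =>
    rw [sum_range_succ, ← ih, ← two_mul, mul_left_comm, ← pow_succ']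
    exact (sum_Ioc_consecutive f (Nat.le_mul_of_pos_right U (Nat.two_pow_pos J))
      (Nat.mul_le_mul_left U (Nat.pow_le_pow_right (by norm_num) (Nat.le_succ J)))).symm

/-! ### The functional `T` -/

open scoped Classical in
/-- Vaughan's weighted sum over primitive characters,
`T(F) = ∑_{q ≤ Q} (q/φ(q)) ∑*_{χ mod q} |F(q, χ)|` (Vaughan 1980, (1) with `F = max |ψ|`).
[cite: Vaughan1980, (1)] -/
noncomputable def Tfun (Q : ℕ) (F : (q : ℕ) → DirichletCharacter ℂ q → ℂ) : ℝ :=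
  ∑ q ∈ Icc 1 Q, (q : ℝ) / q.totient *
    ∑ χ : DirichletCharacter ℂ q with χ.IsPrimitive, ‖F q χ‖

/-- `T(F) ≥ 0`. [folklore] -/
theorem Tfun_nonneg (Q : ℕ) (F : (q : ℕ) → DirichletCharacter ℂ q → ℂ) : 0 ≤ Tfun Q F :=
  sum_nonneg fun q _ => mul_nonneg (by positivity) (sum_nonneg fun _ _ => norm_nonneg _)

/-- Monotonicity of `T` under pointwise bounds. [folklore] -/
theorem Tfun_mono {Q : ℕ} {F G : (q : ℕ) → DirichletCharacter ℂ q → ℂ}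
    (h : ∀ q, 1 ≤ q → q ≤ Q → ∀ χ : DirichletCharacter ℂ q, χ.IsPrimitive → ‖F q χ‖ ≤ ‖G q χ‖) :
    Tfun Q F ≤ Tfun Q G := by
  classical
  unfold Tfun
  refine sum_le_sum fun q hq =>
    mul_le_mul_of_nonneg_left (sum_le_sum fun χ hχ => ?_) (by positivity)
  rw [mem_Icc] at hq
  exact h q hq.1 hq.2 χ (mem_filter.1 hχ).2

/-- Subadditivity of `T`. [folklore] -/
theorem Tfun_add_le (Q : ℕ) (F G : (q : ℕ) → DirichletCharacter ℂ q → ℂ) :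
    Tfun Q (fun q χ => F q χ + G q χ) ≤ Tfun Q F + Tfun Q G := by
  classical
  unfold Tfun
  rw [← sum_add_distrib]
  refine sum_le_sum fun q _ => ?_
  rw [← mul_add, ← sum_add_distrib]
  exact mul_le_mul_of_nonneg_left (sum_le_sum fun χ _ => norm_add_le _ _) (by positivity)

/-- `T(−F) = T(F)`. [folklore] -/
theorem Tfun_neg (Q : ℕ) (F : (q : ℕ) → DirichletCharacter ℂ q → ℂ) :
    Tfun Q (fun q χ => -F q χ) = Tfun Q F := by
  classical
  unfold Tfun; simp only [norm_neg]

/-- `T(F − G) ≤ T(F) + T(G)`. [folklore] -/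
theorem Tfun_sub_le (Q : ℕ) (F G : (q : ℕ) → DirichletCharacter ℂ q → ℂ) :
    Tfun Q (fun q χ => F q χ - G q χ) ≤ Tfun Q F + Tfun Q G := by
  have h := Tfun_add_le Q F (fun q χ => -G q χ)
  rw [Tfun_neg] at h
  simpa only [sub_eq_add_neg] using h

/-- `T` of a finite sum. [folklore] -/
theorem Tfun_sum_le (Q : ℕ) (s : Finset ℕ) (F : ℕ → (q : ℕ) → DirichletCharacter ℂ q → ℂ) :
    Tfun Q (fun q χ => ∑ i ∈ s, F i q χ) ≤ ∑ i ∈ s, Tfun Q (F i) := by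
  classical
  induction s using Finset.induction_on with
  | empty => simp [Tfun]
  | insert i s hi ih =>
    rw [sum_insert hi]
    refine le_trans ?_ (add_le_add le_rfl ih)
    refine le_trans (le_of_eq ?_) (Tfun_add_le Q (F i) fun q χ => ∑ i ∈ s, F i q χ)
    congr 1; ext q χ; rw [sum_insert hi]

open scoped Classical in
/-- There are at most `φ(q)` primitive characters mod `q`. [folklore] -/
theorem card_filter_isPrimitive_le (q : ℕ) [NeZero q] :
    #((univ : Finset (DirichletCharacter ℂ q)).filter fun χ => χ.IsPrimitive) ≤ q.totient := by
  have h1 : #((univ : Finset (DirichletCharacter ℂ q)).filter fun χ => χ.IsPrimitive) ≤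
      Fintype.card (DirichletCharacter ℂ q) := (card_filter_le _ _).trans (card_univ.le)
  have h2 : Fintype.card (DirichletCharacter ℂ q) = q.totient := by
    rw [← Nat.card_eq_fintype_card]
    exact DirichletCharacter.card_eq_totient_of_hasEnoughRootsOfUnity ℂ q
  exact h2 ▸ h1

/-- **Uniform bounds**: if `|F(q, χ)| ≤ g(q)` for all primitive `χ mod q`, then
`T(F) ≤ ∑_{q ≤ Q} q g(q)`. [folklore] -/
theorem Tfun_le_of_forall_le {Q : ℕ} {F : (q : ℕ) → DirichletCharacter ℂ q → ℂ} {g : ℕ → ℝ}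
    (hg : ∀ q, 1 ≤ q → q ≤ Q → 0 ≤ g q)
    (h : ∀ q, 1 ≤ q → q ≤ Q → ∀ χ : DirichletCharacter ℂ q, χ.IsPrimitive → ‖F q χ‖ ≤ g q) :
    Tfun Q F ≤ ∑ q ∈ Icc 1 Q, (q : ℝ) * g q := by
  classical
  unfold Tfun
  refine sum_le_sum fun q hq => ?_
  rw [mem_Icc] at hq
  have : NeZero q := ⟨by omega⟩
  have hφ : (0 : ℝ) < q.totient := by exact_mod_cast Nat.totient_pos.2 (by omega)
  calc (q : ℝ) / q.totient * ∑ χ : DirichletCharacter ℂ q with χ.IsPrimitive, ‖F q χ‖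
      ≤ (q : ℝ) / q.totient * ∑ χ : DirichletCharacter ℂ q with χ.IsPrimitive, g q :=
        mul_le_mul_of_nonneg_left (sum_le_sum fun χ hχ => h q hq.1 hq.2 χ (mem_filter.1 hχ).2)
          (by positivity)
    _ = (q : ℝ) / q.totient * (#((univ : Finset (DirichletCharacter ℂ q)).filter
          fun χ => χ.IsPrimitive) * g q) := by rw [sum_const, nsmul_eq_mul]
    _ ≤ (q : ℝ) / q.totient * (q.totient * g q) := by
        gcongr
        · exact hg q hq.1 hq.2
        · exact_mod_cast card_filter_isPrimitive_le q
    _ = q * g q := by field_simp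

/-- **Uniform bounds with the modulus-one term separated**: if `|F(1, χ)| ≤ A` and
`|F(q, χ)| ≤ B √q (1 + log q)` for `2 ≤ q ≤ Q` and primitive `χ`, then
`T(F) ≤ A + B Q^{5/2} (1 + log Q)`. [folklore] -/
theorem Tfun_le_of_le_one_of_le {Q : ℕ} (hQ : 1 ≤ Q) {F : (q : ℕ) → DirichletCharacter ℂ q → ℂ}
    {A B : ℝ} (hA : 0 ≤ A) (hB : 0 ≤ B)
    (h1 : ∀ χ : DirichletCharacter ℂ 1, ‖F 1 χ‖ ≤ A)
    (h2 : ∀ q, 2 ≤ q → q ≤ Q → ∀ χ : DirichletCharacter ℂ q, χ.IsPrimitive →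
      ‖F q χ‖ ≤ B * (Real.sqrt q * (1 + Real.log q))) :
    Tfun Q F ≤ A + B * ((Q : ℝ) ^ 2 * Real.sqrt Q * (1 + Real.log Q)) := by
  set g : ℕ → ℝ := fun q => if q = 1 then A else B * (Real.sqrt q * (1 + Real.log q)) with hgdef
  have hlog : ∀ q : ℕ, 1 ≤ q → 0 ≤ Real.log q := fun q hq => Real.log_nonneg (by exact_mod_cast hq)
  have hg0 : ∀ q, 1 ≤ q → q ≤ Q → 0 ≤ g q := by
    intro q hq _
    simp only [hgdef]; split_ifs
    · exact hA
    · have := hlog q hq; positivity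
  have hg : ∀ q, 1 ≤ q → q ≤ Q → ∀ χ : DirichletCharacter ℂ q, χ.IsPrimitive → ‖F q χ‖ ≤ g q := by
    intro q hq hqQ χ hχ
    simp only [hgdef]
    split_ifs with h
    · subst h; exact h1 χ
    · exact h2 q (by omega) hqQ χ hχ
  refine (Tfun_le_of_forall_le hg0 hg).trans ?_
  have hsplit : Icc 1 Q = insert 1 (Icc 2 Q) := by
    ext q; simp only [mem_Icc, mem_insert]; omega
  rw [hsplit, sum_insert (by simp)]
  simp only [hgdef, if_true, Nat.cast_one, one_mul]
  refine add_le_add le_rfl ?_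
  have hQ' : (1 : ℝ) ≤ Q := by exact_mod_cast hQ
  have hlogQ := hlog Q hQ
  calc ∑ q ∈ Icc 2 Q, (q : ℝ) * (if q = 1 then A else B * (Real.sqrt q * (1 + Real.log q)))
      = ∑ q ∈ Icc 2 Q, B * ((q : ℝ) * Real.sqrt q * (1 + Real.log q)) := by
        refine sum_congr rfl fun q hq => ?_
        rw [mem_Icc] at hq
        rw [if_neg (by omega)]; ring
    _ ≤ ∑ q ∈ Icc 2 Q, B * ((Q : ℝ) * Real.sqrt Q * (1 + Real.log Q)) := by
        refine sum_le_sum fun q hq => mul_le_mul_of_nonneg_left ?_ hB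
        rw [mem_Icc] at hq
        have hqQ : (q : ℝ) ≤ Q := by exact_mod_cast hq.2
        have hq1 : (1 : ℝ) ≤ q := by exact_mod_cast (by omega : 1 ≤ q)
        gcongr
    _ = (#(Icc 2 Q) : ℝ) * (B * ((Q : ℝ) * Real.sqrt Q * (1 + Real.log Q))) := by
        rw [sum_const, nsmul_eq_mul]
    _ ≤ Q * (B * ((Q : ℝ) * Real.sqrt Q * (1 + Real.log Q))) := by
        refine mul_le_mul_of_nonneg_right ?_ (by positivity)
        have : #(Icc 2 Q) ≤ Q := by simp
        exact_mod_cast this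
    _ = B * ((Q : ℝ) ^ 2 * Real.sqrt Q * (1 + Real.log Q)) := by ring

/-! ### The logarithmic unit and the elementary pieces

From here on `Y₀ = ⌊Y⌋`, the cut-offs `X(q, χ) ≤ Y₀` are arbitrary integers (in the application
`X(q, χ)` realises `max_{X ≤ Y} |ψ(X, χ)|`), and `ℓ = 1 + log Y₀` is the logarithmic unit in
which all elementary bounds are expressed. -/

/-- The logarithmic unit `ℓ = 1 + log Y₀`. [folklore] -/
noncomputable def ell (Y₀ : ℕ) : ℝ := 1 + Real.log Y₀

/-- `1 ≤ ℓ`. [folklore] -/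
theorem one_le_ell (Y₀ : ℕ) : 1 ≤ ell Y₀ := by
  unfold ell; have := Real.log_natCast_nonneg Y₀; linarith

/-- `0 ≤ ℓ`. [folklore] -/
theorem ell_nonneg (Y₀ : ℕ) : 0 ≤ ell Y₀ := zero_le_one.trans (one_le_ell Y₀)

/-- `log n ≤ log Y₀ ≤ ℓ` for `n ≤ Y₀`. [folklore] -/
theorem log_le_log_of_le {Y₀ n : ℕ} (hn : n ≤ Y₀) : Real.log n ≤ Real.log Y₀ := by
  rcases Nat.eq_zero_or_pos n with rfl | hn0
  · rw [Nat.cast_zero, Real.log_zero]; exact Real.log_natCast_nonneg Y₀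
  · exact Real.log_le_log (by exact_mod_cast hn0) (by exact_mod_cast hn)

/-- `1 + log n ≤ ℓ` for `n ≤ Y₀`. [folklore] -/
theorem one_add_log_le_ell {Y₀ n : ℕ} (hn : n ≤ Y₀) : 1 + Real.log n ≤ ell Y₀ := by
  unfold ell; have := log_le_log_of_le hn; linarith

/-- `log n ≤ ℓ` for `n ≤ Y₀`. [folklore] -/
theorem log_le_ell {Y₀ n : ℕ} (hn : n ≤ Y₀) : Real.log n ≤ ell Y₀ := by
  have := one_add_log_le_ell hn; linarith

/-- `log n ≤ ℓ` for `n ≤ 2 Y₀` (`log 2 ≤ 1`). [folklore] -/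
theorem log_le_ell_of_le_two_mul {Y₀ n : ℕ} (hn : n ≤ 2 * Y₀) : Real.log n ≤ ell Y₀ := by
  rcases Nat.eq_zero_or_pos n with rfl | hn0
  · rw [Nat.cast_zero, Real.log_zero]; exact ell_nonneg Y₀
  have hY : 0 < Y₀ := by omega
  unfold ell
  calc Real.log n ≤ Real.log ((2 * Y₀ : ℕ) : ℝ) :=
        Real.log_le_log (by exact_mod_cast hn0) (by exact_mod_cast hn)
    _ = Real.log 2 + Real.log Y₀ := by
        push_cast
        exact Real.log_mul (by norm_num) (by exact_mod_cast hY.ne')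
    _ ≤ 1 + Real.log Y₀ := by
        have : Real.log 2 ≤ 1 := by
          have := Real.log_two_lt_d9; linarith
        linarith

/-! #### The piece `ψ(min(U, X), χ)`: trivially `T ≤ 6 U Q²` -/

/-- `T(ψ(min(U, X), ·)) ≤ (log 4 + 4) U Q²` (Chebyshev's bound `ψ(U) ≤ (log 4 + 4) U` and at most
`φ(q)` primitive characters mod `q`). [folklore] -/
theorem Tfun_psi_min_le (Q U : ℕ) (X : (q : ℕ) → DirichletCharacter ℂ q → ℕ) :
    Tfun Q (fun q χ => chebyshevPsiChar χ ((min U (X q χ) : ℕ) : ℝ)) ≤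
      (Real.log 4 + 4) * U * (Q : ℝ) ^ 2 := by
  have h4 : 0 ≤ Real.log 4 := Real.log_nonneg (by norm_num)
  have hg : ∀ q, 1 ≤ q → q ≤ Q → ∀ χ : DirichletCharacter ℂ q, χ.IsPrimitive →
      ‖chebyshevPsiChar χ ((min U (X q χ) : ℕ) : ℝ)‖ ≤ (Real.log 4 + 4) * U := by
    intro q _ _ χ _
    refine (norm_chebyshevPsiChar_le_psi χ _).trans ?_
    refine (Chebyshev.psi_mono (show ((min U (X q χ) : ℕ) : ℝ) ≤ U by
      exact_mod_cast min_le_left U (X q χ))).trans ?_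
    exact Chebyshev.psi_le_const_mul_self (Nat.cast_nonneg U)
  refine (Tfun_le_of_forall_le (fun q _ _ => by positivity) hg).trans ?_
  calc ∑ q ∈ Icc 1 Q, (q : ℝ) * ((Real.log 4 + 4) * U)
      ≤ ∑ q ∈ Icc 1 Q, (Q : ℝ) * ((Real.log 4 + 4) * U) := by
        refine sum_le_sum fun q hq => ?_
        rw [mem_Icc] at hq
        exact mul_le_mul_of_nonneg_right (by exact_mod_cast hq.2) (by positivity)
    _ = Q * (Q * ((Real.log 4 + 4) * U)) := by simp
    _ = _ := by ring

/-! #### Truncations: `S₁`, `S₂ = S₂' + S₂''` and their trivial bounds -/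

/-- If `f(d) = 0` for `U < d ≤ X` then `‖∑_{d ≤ X} f(d)‖ ≤ ∑_{d ≤ U} ‖f(d)‖`. [folklore] -/
theorem norm_sum_Ioc_le_of_eq_zero {f : ℕ → ℂ} {U X : ℕ}
    (hf : ∀ d, U < d → d ≤ X → f d = 0) :
    ‖∑ d ∈ Ioc 0 X, f d‖ ≤ ∑ d ∈ Ioc 0 U, ‖f d‖ := by
  rw [sum_Ioc_eq_sum_Ioc_of_eq_zero (min_le_right U X) (fun d hd hdX => hf d
    (by by_contra h; exact absurd (le_min (not_lt.1 h) hdX) (not_le.2 hd)) hdX)]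
  refine (norm_sum_le _ _).trans ?_
  exact sum_le_sum_of_subset_of_nonneg (Ioc_subset_Ioc_right (min_le_left U X))
    fun _ _ _ => norm_nonneg _

/-- `∑_{d ≤ U} X/d ≤ Y₀ ℓ` for `X, U ≤ Y₀`. [folklore] -/
theorem sum_Ioc_cast_div_le {U X Y₀ : ℕ} (hX : X ≤ Y₀) (hU : U ≤ Y₀) :
    ∑ d ∈ Ioc 0 U, ((X / d : ℕ) : ℝ) ≤ Y₀ * ell Y₀ := by
  calc ∑ d ∈ Ioc 0 U, ((X / d : ℕ) : ℝ) ≤ ∑ d ∈ Ioc 0 U, (Y₀ : ℝ) * ((d : ℝ))⁻¹ := by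
        refine sum_le_sum fun d _ => ?_
        calc ((X / d : ℕ) : ℝ) ≤ (X : ℝ) / d := Nat.cast_div_le
          _ ≤ (Y₀ : ℝ) / d := div_le_div_of_nonneg_right (by exact_mod_cast hX) (Nat.cast_nonneg d)
          _ = _ := div_eq_mul_inv _ _
    _ = Y₀ * ∑ d ∈ Ioc 0 U, ((d : ℝ))⁻¹ := by rw [mul_sum]
    _ ≤ Y₀ * ell Y₀ :=
        mul_le_mul_of_nonneg_left ((sum_Ioc_inv_le U).trans (one_add_log_le_ell hU))
          (Nat.cast_nonneg Y₀)

/-- `|μ_{≤U}(d) χ(d)| ≤ 1`. [folklore] -/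
theorem norm_moebiusTrunc_mul_char_le (U d : ℕ) {q : ℕ} (χ : DirichletCharacter ℂ q) :
    ‖((Literature.NumberTheory.Sieve.moebiusTrunc U d : ℤ) : ℂ) * χ d‖ ≤ 1 := by
  rw [norm_mul]
  have h1 : ‖((Literature.NumberTheory.Sieve.moebiusTrunc U d : ℤ) : ℂ)‖ ≤ 1 := by
    rw [Complex.norm_intCast, ← Int.cast_abs]
    rw [Literature.NumberTheory.Sieve.moebiusTrunc_apply]
    split_ifs
    · exact_mod_cast abs_moebius_le_one
    · simp
  exact mul_le_one₀ h1 (norm_nonneg _) (χ.norm_le_one _)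

/-- Pointwise truncation of `S₁`: `‖S₁(X, χ)‖ ≤ ∑_{d ≤ U} ‖∑_{m ≤ X/d} (log m) χ(m)‖`. [folklore] -/
theorem norm_S₁_le (U X : ℕ) {q : ℕ} (χ : DirichletCharacter ℂ q) :
    ‖S₁ U X χ‖ ≤ ∑ d ∈ Ioc 0 U, ‖∑ m ∈ Ioc 0 (X / d), (Real.log m : ℂ) * χ m‖ := by
  unfold S₁
  refine (norm_sum_Ioc_le_of_eq_zero fun d hd _ => ?_).trans (sum_le_sum fun d _ => ?_)
  · rw [Literature.NumberTheory.Sieve.moebiusTrunc_apply, if_neg (by omega)]; simp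
  · rw [norm_mul]
    exact mul_le_of_le_one_left (norm_nonneg _) (norm_moebiusTrunc_mul_char_le U d χ)

/-- The trivial bound `‖S₁(X, χ)‖ ≤ Y₀ ℓ²` (any `χ`; used for `q = 1`). [folklore] -/
theorem norm_S₁_le_trivial {U X Y₀ : ℕ} (hX : X ≤ Y₀) (hU : U ≤ Y₀) {q : ℕ}
    (χ : DirichletCharacter ℂ q) : ‖S₁ U X χ‖ ≤ Y₀ * ell Y₀ ^ 2 := by
  refine (norm_S₁_le U X χ).trans ?_
  have hℓ := ell_nonneg Y₀
  calc ∑ d ∈ Ioc 0 U, ‖∑ m ∈ Ioc 0 (X / d), (Real.log m : ℂ) * χ m‖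
      ≤ ∑ d ∈ Ioc 0 U, ((X / d : ℕ) : ℝ) * ell Y₀ := by
        refine sum_le_sum fun d _ => ?_
        refine (norm_sum_mul_char_le χ _ _).trans ?_
        calc ∑ m ∈ Ioc 0 (X / d), ‖(Real.log m : ℂ)‖ = ∑ m ∈ Ioc 0 (X / d), Real.log m :=
              sum_congr rfl fun m _ => by
                rw [Complex.norm_real, Real.norm_of_nonneg (Real.log_natCast_nonneg m)]
          _ ≤ (X / d : ℕ) * Real.log ((X / d : ℕ) : ℝ) := sum_Ioc_log_le _
          _ ≤ _ := by
              refine mul_le_mul_of_nonneg_left (log_le_ell ?_) (Nat.cast_nonneg _)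
              exact (Nat.div_le_self X d).trans hX
    _ = (∑ d ∈ Ioc 0 U, ((X / d : ℕ) : ℝ)) * ell Y₀ := by rw [sum_mul]
    _ ≤ Y₀ * ell Y₀ * ell Y₀ := mul_le_mul_of_nonneg_right (sum_Ioc_cast_div_le hX hU) hℓ
    _ = _ := by ring

/-- `S₂'(X, χ) = ∑_{d ≤ min(U, X)} c_U(d) ∑_{m ≤ X/d} χ(dm)`, the part `d ≤ u` of `S₂`
(Vaughan 1980, §2). [cite: Vaughan1980, §2] -/
noncomputable def S₂' (U X : ℕ) {q : ℕ} (χ : DirichletCharacter ℂ q) : ℂ :=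
  ∑ d ∈ Ioc 0 (min U X), (cU U d : ℂ) * ∑ m ∈ Ioc 0 (X / d), χ (d * m)

/-- `S₂''(X, χ) = ∑_{min(U, X) < d ≤ X} c_U(d) ∑_{m ≤ X/d} χ(dm)`, the part `d > u` of `S₂`
(Vaughan 1980, §2). [cite: Vaughan1980, §2] -/
noncomputable def S₂'' (U X : ℕ) {q : ℕ} (χ : DirichletCharacter ℂ q) : ℂ :=
  ∑ d ∈ Ioc (min U X) X, (cU U d : ℂ) * ∑ m ∈ Ioc 0 (X / d), χ (d * m)

/-- `S₂ = S₂' + S₂''`. [folklore] -/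
theorem S₂_eq_add (U X : ℕ) {q : ℕ} (χ : DirichletCharacter ℂ q) :
    S₂ U X χ = S₂' U X χ + S₂'' U X χ :=
  (sum_Ioc_consecutive _ (Nat.zero_le _) (min_le_right U X)).symm

/-- `‖∑_{m ≤ Z} χ(dm)‖ ≤ ‖∑_{m ≤ Z} χ(m)‖`. [folklore] -/
theorem norm_sum_char_mul_le {q : ℕ} (χ : DirichletCharacter ℂ q) (d Z : ℕ) :
    ‖∑ m ∈ Ioc 0 Z, χ (d * m)‖ ≤ ‖∑ m ∈ Ioc 0 Z, χ m‖ := by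
  have : ∑ m ∈ Ioc 0 Z, χ (d * m) = χ d * ∑ m ∈ Ioc 0 Z, χ m := by
    rw [mul_sum]; exact sum_congr rfl fun m _ => by rw [map_mul]
  rw [this, norm_mul]
  exact mul_le_of_le_one_left (norm_nonneg _) (χ.norm_le_one _)

/-- Pointwise: `‖S₂'(X, χ)‖ ≤ ℓ ∑_{d ≤ U} ‖∑_{m ≤ X/d} χ(m)‖` for `U ≤ Y₀`. [folklore] -/
theorem norm_S₂'_le {U X Y₀ : ℕ} (hU : U ≤ Y₀) {q : ℕ} (χ : DirichletCharacter ℂ q) :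
    ‖S₂' U X χ‖ ≤ ell Y₀ * ∑ d ∈ Ioc 0 U, ‖∑ m ∈ Ioc 0 (X / d), χ m‖ := by
  unfold S₂'
  refine (norm_sum_le _ _).trans ?_
  calc ∑ d ∈ Ioc 0 (min U X), ‖(cU U d : ℂ) * ∑ m ∈ Ioc 0 (X / d), χ (d * m)‖
      ≤ ∑ d ∈ Ioc 0 (min U X), ell Y₀ * ‖∑ m ∈ Ioc 0 (X / d), χ m‖ := by
        refine sum_le_sum fun d hd => ?_
        rw [mem_Ioc] at hd
        rw [norm_mul, Complex.norm_real, Real.norm_eq_abs]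
        refine mul_le_mul ((abs_cU_le_log U d).trans (log_le_ell (by omega)))
          (norm_sum_char_mul_le χ d _) (norm_nonneg _) (ell_nonneg Y₀)
    _ ≤ ∑ d ∈ Ioc 0 U, ell Y₀ * ‖∑ m ∈ Ioc 0 (X / d), χ m‖ :=
        sum_le_sum_of_subset_of_nonneg (Ioc_subset_Ioc_right (min_le_left U X))
          fun _ _ _ => mul_nonneg (ell_nonneg Y₀) (norm_nonneg _)
    _ = _ := by rw [mul_sum]

/-- The trivial bound `‖S₂'(X, χ)‖ ≤ Y₀ ℓ²`. [folklore] -/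
theorem norm_S₂'_le_trivial {U X Y₀ : ℕ} (hX : X ≤ Y₀) (hU : U ≤ Y₀) {q : ℕ}
    (χ : DirichletCharacter ℂ q) : ‖S₂' U X χ‖ ≤ Y₀ * ell Y₀ ^ 2 := by
  refine (norm_S₂'_le hU χ).trans ?_
  have hℓ := ell_nonneg Y₀
  calc ell Y₀ * ∑ d ∈ Ioc 0 U, ‖∑ m ∈ Ioc 0 (X / d), χ m‖
      ≤ ell Y₀ * ∑ d ∈ Ioc 0 U, ((X / d : ℕ) : ℝ) := by
        refine mul_le_mul_of_nonneg_left (sum_le_sum fun d _ => ?_) hℓ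
        refine (norm_sum_le _ _).trans ?_
        calc ∑ m ∈ Ioc 0 (X / d), ‖χ m‖ ≤ ∑ m ∈ Ioc 0 (X / d), (1 : ℝ) :=
              sum_le_sum fun m _ => χ.norm_le_one _
          _ = _ := by simp
    _ ≤ ell Y₀ * (Y₀ * ell Y₀) := mul_le_mul_of_nonneg_left (sum_Ioc_cast_div_le hX hU) hℓ
    _ = _ := by ring

/-! #### Dyadic blocks for the type II pieces `S₂''` and `S₃` -/

/-- A type II block `B_M(X, χ) = ∑_{M < d ≤ 2M} a(d) ∑_{m ≤ X/d} b(m) χ(dm)` (Vaughan 1980, §2,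
the sums `S₃(M)`). [cite: Vaughan1980, §2] -/
noncomputable def blockSum (a b : ℕ → ℝ) (M X : ℕ) {q : ℕ} (χ : DirichletCharacter ℂ q) : ℂ :=
  ∑ d ∈ Ioc M (M + M), (a d : ℂ) * ∑ m ∈ Ioc 0 (X / d), (b m : ℂ) * χ (d * m)

/-- Relocating a sum over `(min(U, X), X]` to `(U, B]`, `B ≥ X`, when the summand vanishes
beyond `X`. [folklore] -/
theorem sum_Ioc_min_eq {M : Type*} [AddCommMonoid M] {f : ℕ → M} {U X B : ℕ} (hXB : X ≤ B)
    (hf : ∀ d, X < d → f d = 0) :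
    ∑ d ∈ Ioc (min U X) X, f d = ∑ d ∈ Ioc U B, f d := by
  rcases le_total U X with h | h
  · rw [min_eq_left h, ← sum_Ioc_consecutive f h hXB]
    have : ∑ d ∈ Ioc X B, f d = 0 := sum_eq_zero fun d hd => hf d (mem_Ioc.1 hd).1
    rw [this, add_zero]
  · rw [min_eq_right h, Finset.Ioc_self, sum_empty]
    exact (sum_eq_zero fun d hd => hf d (lt_of_le_of_lt h (mem_Ioc.1 hd).1)).symm

/-- The inner sum `∑_{m ≤ X/d}` is empty for `d > X`. [folklore] -/
theorem sum_Ioc_div_eq_zero_of_lt {M : Type*} [AddCommMonoid M] (g : ℕ → M) {X d : ℕ}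
    (hd : X < d) : ∑ m ∈ Ioc 0 (X / d), g m = 0 := by
  rw [Nat.div_eq_of_lt hd, Finset.Ioc_self, sum_empty]

/-- `S₂''` as a sum of dyadic blocks: for `X ≤ U 2^J`,
`S₂''(X, χ) = ∑_{i < J} B_{U 2^i}(X, χ)` with `a = c_U`, `b = 1`. [folklore] -/
theorem S₂''_eq_sum_blockSum {U X J : ℕ} (hJ : X ≤ U * 2 ^ J) {q : ℕ}
    (χ : DirichletCharacter ℂ q) :
    S₂'' U X χ = ∑ i ∈ range J, blockSum (cU U) (fun _ => 1) (U * 2 ^ i) X χ := by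
  unfold S₂'' blockSum
  rw [sum_Ioc_min_eq hJ (fun d hd => by rw [sum_Ioc_div_eq_zero_of_lt _ hd, mul_zero]),
    sum_Ioc_mul_two_pow_eq_sum]
  simp only [Complex.ofReal_one, one_mul]

/-- `S₃` as a sum of dyadic blocks: for `X ≤ U 2^J`,
`S₃(X, χ) = ∑_{i < J} B_{U 2^i}(X, χ)` with `a = F_U`, `b = G_U`. [folklore] -/
theorem S₃_eq_sum_blockSum {U X J : ℕ} (hJ : X ≤ U * 2 ^ J) {q : ℕ}
    (χ : DirichletCharacter ℂ q) :
    S₃ U X χ = ∑ i ∈ range J, blockSum (fU U) (gU U) (U * 2 ^ i) X χ := by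
  unfold S₃ blockSum
  rw [← sum_Ioc_consecutive _ (Nat.zero_le _) (min_le_right U X)]
  have h0 : ∑ d ∈ Ioc 0 (min U X),
      (fU U d : ℂ) * ∑ m ∈ Ioc 0 (X / d), (gU U m : ℂ) * χ (d * m) = 0 := by
    refine sum_eq_zero fun d hd => ?_
    rw [mem_Ioc] at hd
    rw [fU_apply, if_pos (le_trans hd.2 (min_le_left U X)), Complex.ofReal_zero, zero_mul]
  rw [h0, zero_add,
    sum_Ioc_min_eq hJ (fun d hd => by rw [sum_Ioc_div_eq_zero_of_lt _ hd, mul_zero]),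
    sum_Ioc_mul_two_pow_eq_sum]

/-- A block in the form required by the hyperbolic large sieve: for `0 < M` and `X ≤ Y₀`,
`B_M(X, χ) = ∑_{M < d ≤ 2M} ∑_{m ≤ Y₀/M} [dm ≤ X] a(d) b(m) χ(dm)`. [folklore] -/
theorem blockSum_eq_sum_ite (a b : ℕ → ℝ) {M X Y₀ : ℕ} (hM : 0 < M) (hX : X ≤ Y₀) {q : ℕ}
    (χ : DirichletCharacter ℂ q) :
    blockSum a b M X χ = ∑ d ∈ Ioc M (M + M), ∑ m ∈ Ioc 0 (0 + Y₀ / M),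
      (if d * m ≤ X then (a d : ℂ) * (b m : ℂ) * χ (d * m) else 0) := by
  unfold blockSum
  refine sum_congr rfl fun d hd => ?_
  rw [mem_Ioc] at hd
  have hd0 : 0 < d := lt_trans hM hd.1
  have hle : X / d ≤ Y₀ / M := Nat.div_le_div hX hd.1.le (by omega)
  rw [sum_Ioc_div_eq_sum_ite _ hd0 hle, zero_add, mul_sum]
  refine sum_congr rfl fun m _ => ?_
  split_ifs
  · rw [mul_assoc]
  · rw [mul_zero]

/-- `‖(x : ℂ)‖² = x²`. [folklore] -/
theorem norm_ofReal_sq (x : ℝ) : ‖(x : ℂ)‖ ^ 2 = x ^ 2 := by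
  rw [Complex.norm_real, Real.norm_eq_abs, sq_abs]

/-- `√M √(Y₀/M) ≤ √Y₀`. [folklore] -/
theorem sqrt_mul_sqrt_div_le (M Y₀ : ℕ) :
    Real.sqrt M * Real.sqrt (Y₀ / M : ℕ) ≤ Real.sqrt Y₀ := by
  rw [← Real.sqrt_mul (Nat.cast_nonneg M)]
  exact Real.sqrt_le_sqrt (by exact_mod_cast Nat.mul_div_le Y₀ M)

/-- `√(Y₀/M) ≤ √Y₀/√U` for `1 ≤ U ≤ M`. [folklore] -/
theorem sqrt_div_le_sqrt_div_sqrt {U M Y₀ : ℕ} (hU : 1 ≤ U) (hUM : U ≤ M) :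
    Real.sqrt (Y₀ / M : ℕ) ≤ Real.sqrt Y₀ / Real.sqrt U := by
  rw [le_div_iff₀ (Real.sqrt_pos.2 (by exact_mod_cast hU)), ← Real.sqrt_mul (Nat.cast_nonneg _)]
  refine Real.sqrt_le_sqrt ?_
  have : Y₀ / M * U ≤ Y₀ := (Nat.mul_le_mul_left _ hUM).trans (Nat.div_mul_le_self Y₀ M)
  exact_mod_cast this

/-- `√M ≤ √Y₀/√U` when `U M ≤ Y₀`, `1 ≤ U`. [folklore] -/
theorem sqrt_le_sqrt_div_sqrt {U M Y₀ : ℕ} (hU : 1 ≤ U) (hUM : U * M ≤ Y₀) :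
    Real.sqrt M ≤ Real.sqrt Y₀ / Real.sqrt U := by
  rw [le_div_iff₀ (Real.sqrt_pos.2 (by exact_mod_cast hU)), ← Real.sqrt_mul (Nat.cast_nonneg _)]
  refine Real.sqrt_le_sqrt ?_
  rw [mul_comm] at hUM
  exact_mod_cast hUM

/-- `√M ≤ U` when `M < U²`. [folklore] -/
theorem sqrt_le_of_lt_mul_self {U M : ℕ} (h : M < U * U) : Real.sqrt M ≤ U := by
  rw [Real.sqrt_le_left (Nat.cast_nonneg U), sq]
  exact_mod_cast h.le

/-- A block of `S₃` beyond `Y₀/U` vanishes: if `Y₀ ≤ U M` then `B_M(X, χ) = 0` for `X ≤ Y₀`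
(`m ≤ X/d < Y₀/M ≤ U` forces `G_U(m) = 0`). [folklore] -/
theorem blockSum_fU_gU_eq_zero {U M X Y₀ : ℕ} (hX : X ≤ Y₀) (hUM : Y₀ ≤ U * M) {q : ℕ}
    (χ : DirichletCharacter ℂ q) : blockSum (fU U) (gU U) M X χ = 0 := by
  unfold blockSum
  refine sum_eq_zero fun d hd => ?_
  rw [mem_Ioc] at hd
  have hinner : ∑ m ∈ Ioc 0 (X / d), (gU U m : ℂ) * χ (d * m) = 0 := by
    refine sum_eq_zero fun m hm => ?_
    rw [mem_Ioc] at hm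
    have hmU : m ≤ U := by
      by_contra h
      replace h := not_le.1 h
      have h1 : m * d ≤ X := (Nat.le_div_iff_mul_le (by omega)).1 hm.2
      have h2 : U * M < m * d := Nat.mul_lt_mul'' h hd.1
      omega
    rw [gU_eq_zero_of_le hmU, Complex.ofReal_zero, zero_mul]
  rw [hinner, mul_zero]

/-- A block of `S₂''` beyond `U²` vanishes: if `U² ≤ M` then `B_M(X, χ) = 0`
(`c_U(d) = 0` for `d > U²`). [folklore] -/
theorem blockSum_cU_eq_zero {U M X : ℕ} (hUM : U * U ≤ M) (b : ℕ → ℝ) {q : ℕ}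
    (χ : DirichletCharacter ℂ q) : blockSum (cU U) b M X χ = 0 := by
  unfold blockSum
  refine sum_eq_zero fun d hd => ?_
  rw [mem_Ioc] at hd
  rw [cU_eq_zero_of_lt (lt_of_le_of_lt hUM hd.1), Complex.ofReal_zero, zero_mul]

/-- `T` of the zero function vanishes. [folklore] -/
theorem Tfun_eq_zero_of_forall {Q : ℕ} {F : (q : ℕ) → DirichletCharacter ℂ q → ℂ}
    (h : ∀ q, 1 ≤ q → q ≤ Q → ∀ χ : DirichletCharacter ℂ q, F q χ = 0) : Tfun Q F = 0 := by
  classical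
  unfold Tfun
  refine sum_eq_zero fun q hq => ?_
  rw [mem_Icc] at hq
  rw [sum_eq_zero fun χ _ => by rw [h q hq.1 hq.2 χ, norm_zero], mul_zero]

/-- The number of dyadic blocks: `J = log₂ Y₀ + 1 ≤ 2ℓ` and `Y₀ < 2^J`. [folklore] -/
theorem natLog_two_add_one_le (Y₀ : ℕ) : ((Nat.log 2 Y₀ + 1 : ℕ) : ℝ) ≤ 2 * ell Y₀ := by
  rcases Nat.eq_zero_or_pos Y₀ with rfl | hY
  · simp [ell]
  have h1 : ((2 ^ Nat.log 2 Y₀ : ℕ) : ℝ) ≤ Y₀ := by exact_mod_cast Nat.pow_log_le_self 2 hY.ne'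
  have h2 : (Nat.log 2 Y₀ : ℝ) * Real.log 2 ≤ Real.log Y₀ := by
    rw [← Real.log_pow]
    exact Real.log_le_log (by positivity) (by exact_mod_cast h1)
  have h3 := Real.log_two_gt_d9
  have h4 : (Nat.log 2 Y₀ : ℝ) ≤ 2 * Real.log Y₀ := by
    have h0 : (0 : ℝ) ≤ Nat.log 2 Y₀ := Nat.cast_nonneg _
    nlinarith
  unfold ell; push_cast; linarith

/-- `log 4 + 4 ≤ 6`. [folklore] -/
theorem log_four_add_four_le_six : Real.log 4 + 4 ≤ 6 := by
  have : Real.log 4 = 2 * Real.log 2 := by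
    rw [show (4 : ℝ) = 2 ^ 2 by norm_num, Real.log_pow]; push_cast; ring
  have h := Real.log_two_lt_d9
  linarith

/-- `∑_{M < d ≤ 2M} F_U(d)² ≤ 12 M ℓ` for `M ≤ Y₀` (Chebyshev). [folklore] -/
theorem sum_sq_fU_le {U M Y₀ : ℕ} (hMY : M ≤ Y₀) :
    ∑ d ∈ Ioc M (M + M), fU U d ^ 2 ≤ 12 * M * ell Y₀ := by
  have h1 := log_four_add_four_le_six
  have h2 : Real.log ((M + M : ℕ) : ℝ) ≤ ell Y₀ := log_le_ell_of_le_two_mul (by omega)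
  have h3 : 0 ≤ Real.log ((M + M : ℕ) : ℝ) := Real.log_natCast_nonneg _
  have h5 : 0 ≤ Real.log 4 := Real.log_nonneg (by norm_num)
  calc ∑ d ∈ Ioc M (M + M), fU U d ^ 2 ≤ ∑ d ∈ Ioc 0 (M + M), (Λ d) ^ 2 := by
        refine (sum_le_sum fun d _ => ?_).trans (sum_le_sum_of_subset_of_nonneg
          (Ioc_subset_Ioc_left (Nat.zero_le M)) fun _ _ _ => by positivity)
        rw [← sq_abs (fU U d)]
        exact pow_le_pow_left₀ (abs_nonneg _) (abs_fU_le U d) 2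
    _ ≤ (Real.log 4 + 4) * ((M + M : ℕ) : ℝ) * Real.log ((M + M : ℕ) : ℝ) :=
        sum_vonMangoldt_sq_le (M + M)
    _ ≤ 6 * ((M + M : ℕ) : ℝ) * ell Y₀ :=
        mul_le_mul (mul_le_mul_of_nonneg_right h1 (Nat.cast_nonneg _)) h2 h3 (by positivity)
    _ = 12 * M * ell Y₀ := by push_cast; ring

/-- `∑_{m ≤ N} G_U(m)² ≤ N ℓ³` for `N ≤ Y₀` (mean square of the divisor function). [folklore] -/
theorem sum_sq_gU_le {U N Y₀ : ℕ} (hN : N ≤ Y₀) :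
    ∑ m ∈ Ioc 0 N, gU U m ^ 2 ≤ N * ell Y₀ ^ 3 := by
  calc ∑ m ∈ Ioc 0 N, gU U m ^ 2 ≤ ∑ m ∈ Ioc 0 N, ((#m.divisors : ℕ) : ℝ) ^ 2 := by
        refine sum_le_sum fun m _ => ?_
        rw [← sq_abs (gU U m)]
        refine pow_le_pow_left₀ (abs_nonneg _) ((abs_gU_le U m).trans_eq ?_) 2
        rw [sigma_zero_apply]
    _ ≤ N * (1 + Real.log N) ^ 3 := sum_sq_card_divisors_le N
    _ ≤ N * ell Y₀ ^ 3 := by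
        refine mul_le_mul_of_nonneg_left ?_ (Nat.cast_nonneg N)
        exact pow_le_pow_left₀ (by have := Real.log_natCast_nonneg N; linarith)
          (one_add_log_le_ell hN) 3

/-- `∑_{M < d ≤ 2M} c_U(d)² ≤ M ℓ²` for `M ≤ Y₀`. [folklore] -/
theorem sum_sq_cU_le {U M Y₀ : ℕ} (hMY : M ≤ Y₀) :
    ∑ d ∈ Ioc M (M + M), cU U d ^ 2 ≤ M * ell Y₀ ^ 2 := by
  calc ∑ d ∈ Ioc M (M + M), cU U d ^ 2 ≤ ∑ d ∈ Ioc M (M + M), ell Y₀ ^ 2 := by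
        refine sum_le_sum fun d hd => ?_
        rw [mem_Ioc] at hd
        rw [← sq_abs (cU U d)]
        exact pow_le_pow_left₀ (abs_nonneg _)
          ((abs_cU_le_log U d).trans (log_le_ell_of_le_two_mul (by omega))) 2
    _ = M * ell Y₀ ^ 2 := by
        rw [sum_const, Nat.card_Ioc, Nat.add_sub_cancel, nsmul_eq_mul]

/-- The dyadic range: `∃ J ≤ 2ℓ` with `Y₀ ≤ U 2^J` (`U ≥ 1`). [folklore] -/
theorem exists_dyadic_range {U : ℕ} (hU : 1 ≤ U) (Y₀ : ℕ) :
    ∃ J : ℕ, Y₀ ≤ U * 2 ^ J ∧ (J : ℝ) ≤ 2 * ell Y₀ := by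
  refine ⟨Nat.log 2 Y₀ + 1, ?_, by exact_mod_cast natLog_two_add_one_le Y₀⟩
  have : Y₀ < 2 ^ (Nat.log 2 Y₀ + 1) := Nat.lt_pow_succ_log_self (by norm_num) Y₀
  nlinarith

/-! #### `ψ(X, χ)` as a one-row bilinear form (for the case `Q² > Y`) -/

/-- `ψ(X, χ)` as a hyperbolic bilinear form with a single row:
`ψ(X, χ) = ∑_{m ∈ (0,1]} ∑_{n ∈ (0,Y₀]} [mn ≤ X] 1 · Λ(n) χ(mn)` for `X ≤ Y₀`. [folklore] -/
theorem chebyshevPsiChar_eq_sum_ite {X Y₀ : ℕ} (hX : X ≤ Y₀) {q : ℕ}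
    (χ : DirichletCharacter ℂ q) :
    chebyshevPsiChar χ X = ∑ m ∈ Ioc 0 (0 + 1), ∑ n ∈ Ioc 0 (0 + Y₀),
      (if m * n ≤ X then (1 : ℂ) * ((Λ n : ℝ) : ℂ) * χ (m * n) else 0) := by
  have h := sum_Ioc_div_eq_sum_ite (fun n => ((Λ n : ℝ) : ℂ) * χ n) (d := 1) (X := X) one_pos
    (show X / 1 ≤ 0 + Y₀ by rw [Nat.div_one, zero_add]; exact hX)
  rw [Nat.div_one] at h
  rw [Nat.Ioc_succ_singleton, sum_singleton, chebyshevPsiChar_natCast, h]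
  refine sum_congr rfl fun n _ => ?_
  simp only [zero_add, Nat.cast_one, one_mul]

/-! #### The maximising cut-offs -/

open scoped Classical in
/-- The averaged maximum in `vaughan_meanValue` is `T(ψ(X(·), ·))` for maximising integer
cut-offs `X(q, χ) ≤ ⌊Y⌋`. [folklore] -/
theorem exists_cutoff (Q : ℕ) (Y : ℝ) :
    ∃ X : (q : ℕ) → DirichletCharacter ℂ q → ℕ, (∀ q χ, X q χ ≤ ⌊Y⌋₊) ∧
      ∑ q ∈ Icc 1 Q, (q : ℝ) / (Nat.totient q) *
        ∑ χ : DirichletCharacter ℂ q with χ.IsPrimitive, chebyshevPsiCharSup χ Y =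
      Tfun Q (fun q χ => chebyshevPsiChar χ (X q χ)) := by
  classical
  have hX : ∀ q (χ : DirichletCharacter ℂ q), ∃ N : ℕ, N ≤ ⌊Y⌋₊ ∧
      chebyshevPsiCharSup χ Y = ‖chebyshevPsiChar χ N‖ := by
    intro q χ
    obtain ⟨N, hN, hEq⟩ := Finset.exists_mem_eq_sup' (s := range (⌊Y⌋₊ + 1)) ⟨0, by simp⟩
      (fun N : ℕ => ‖chebyshevPsiChar χ N‖)
    exact ⟨N, Nat.lt_succ_iff.1 (mem_range.1 hN), by unfold chebyshevPsiCharSup; exact hEq⟩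
  choose X hXle hXeq using hX
  refine ⟨X, hXle, ?_⟩
  unfold Tfun
  refine sum_congr rfl fun q _ => ?_
  congr 1
  exact sum_congr rfl fun χ _ => hXeq q χ

end Literature.NumberTheory.Sieve.Vaughan
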